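import Summits.ABC.ABC.Theorems.IsogenyGlueCongruenceKenkuPrintedLevelsLevelThirtyFiveLink
import Literature.NumberTheory.EllipticCurves.ThreeIsogeny
import HarnessLib

/-!
# `KenkuPrintedLevels` (stmt-ABC-18224) (ii), level `35`: the one remaining input stated in the tree's
# `3`-isogeny vocabulary (`threeTorsionModel 4 28` = Cremona `35a1`)

`Summits/ABC/ABC/Theorems/IsogenyGlueCongruenceKenkuPrintedLevelsLevelThirtyFiveOfThreeTorsionModel.lean` — unit
`abc-inputs-pr-1` (KEY A1L-SWEEP parcel 2; progress, not closure). PROOFS ONLY (0 definitions, 0 named facts).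
`…LevelThirtyFiveLink.lean` proves "no cyclic rational `35`-isogeny" from the single displayed hypothesis
`∀ X Y : ℚ, Y² = X³ + (4X + 28)² → X = 0`. That curve is `WeierstrassCurve.threeTorsionModel 4 28 = [0, 16, 0, 224, 784]`
of `Literature/NumberTheory/EllipticCurves/ThreeIsogeny.lean` (the tree's model `E_{m,s} : y² = x³ + (mx + s)²` of a curve
with the rational `3`-torsion point `T = (0, s)`, here `(0, 28)`; Vélu's `3`-isogeny onto `threeIsogenyCodomain 4 28 =
[0, 16, 0, −2016, −49840]` is `IsVeluThreePair.pointHom`), i.e. Cremona `35a1` (`Δ = 16·28³·(4·4³ − 27·28) = −2¹²5³7³`).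
This file restates the input on that object, so that a `3`-isogeny descent written against `ThreeIsogeny.lean` closes
level `35` by `isCyclic_degree_ne_thirtyFive_of_threeTorsionModel`. The input itself (`35a1(ℚ) ≅ ℤ/3`, Cremona) is NOT
proved here. Nothing is conditional on a named fact; no summit, rung or item is proved; abc moved by 0.
[cite: Kenku1982, Thm. 1 and its proof, pp. 199–201]
-/

-- `Summit.ABC.ABC` is the mandated summit-side namespace (CONVENTIONS §2); the duplicate is deliberate.
set_option linter.dupNamespace false

noncomputable section
open WeierstrassCurve
open Literature.NumberTheory.EllipticCurves

namespace Summit.ABC.ABC.Theorems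

/-- `threeTorsionModel 4 28` (`= [0,16,0,224,784]`, Cremona `35a1` up to `u = 2`) is nonsingular:
`Δ = 16·28³·(256 − 756) ≠ 0`. [folklore] -/
theorem threeTorsionModel_four_twentyEight_Δ_ne_zero : (threeTorsionModel (4 : ℚ) 28).Δ ≠ 0 := by
  rw [Δ_threeTorsionModel]; norm_num

/-- The affine points of `threeTorsionModel 4 28` are exactly the rational solutions of `Y² = X³ + (4X + 28)²`.
[folklore] -/
theorem threeTorsionModel_four_twentyEight_equation_iff (X Y : ℚ) :
    (threeTorsionModel (4 : ℚ) 28).toAffine.Equation X Y ↔ Y ^ 2 = X ^ 3 + (4 * X + 28) ^ 2 := by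
  rw [(isVeluThreePair_threeTorsionModel threeTorsionModel_four_twentyEight_Δ_ne_zero).equation_iff X Y]
  constructor <;> intro h <;> linear_combination h

/-- **Level `35` of `KenkuPrintedLevels` (ii) from the Mordell–Weil group of `threeTorsionModel 4 28` (= `35a1`).**
If every affine rational point of `threeTorsionModel (4 : ℚ) 28` has `X = 0` (i.e. the Mordell–Weil group is
`{O, ±T}`, `T = (0, 28)` the `3`-torsion point of `ThreeIsogeny.lean`; Cremona `35a1(ℚ) ≅ ℤ/3` — NOT proved here, the target
of a `3`-isogeny descent), then no elliptic curve over `ℚ` admits a cyclic `ℚ`-isogeny of degree `35`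
(`isCyclic_degree_ne_thirtyFive_of_mordellWeil`). [cite: Kenku1982, Thm. 1 and its proof, pp. 199–201] -/
theorem isCyclic_degree_ne_thirtyFive_of_threeTorsionModel
    (hMW : ∀ X Y : ℚ, (threeTorsionModel (4 : ℚ) 28).toAffine.Equation X Y → X = 0)
    (V V' : WeierstrassCurve ℚ) [V.IsElliptic] [V'.IsElliptic] (ψ : Isogeny V V')
    (hψ : ψ.IsCyclic) : ψ.degree ≠ 35 :=
  isCyclic_degree_ne_thirtyFive_of_mordellWeil
    (fun X Y h ↦ hMW X Y ((threeTorsionModel_four_twentyEight_equation_iff X Y).mpr h)) V V' ψ hψ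

/-- The same with the hypothesis on nonsingular points (`W.toAffine.Point`-style statements quantify over these);
every affine point of a curve with `Δ ≠ 0` is nonsingular, so this is the form a descent file delivers. [folklore] -/
theorem isCyclic_degree_ne_thirtyFive_of_threeTorsionModel_nonsingular
    (hMW : ∀ X Y : ℚ, (threeTorsionModel (4 : ℚ) 28).toAffine.Nonsingular X Y → X = 0)
    (V V' : WeierstrassCurve ℚ) [V.IsElliptic] [V'.IsElliptic] (ψ : Isogeny V V')
    (hψ : ψ.IsCyclic) : ψ.degree ≠ 35 := by
  refine isCyclic_degree_ne_thirtyFive_of_threeTorsionModel (fun X Y h ↦ hMW X Y ?_) V V' ψ hψ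
  haveI : (threeTorsionModel (4 : ℚ) 28).IsElliptic :=
    ⟨isUnit_iff_ne_zero.mpr threeTorsionModel_four_twentyEight_Δ_ne_zero⟩
  exact (Affine.equation_iff_nonsingular (W := (threeTorsionModel (4 : ℚ) 28).toAffine)).mp h

end Summit.ABC.ABC.Theorems

end
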